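import Literature.MathematicalPhysics.QuantumFieldTheory.Balaban1983to89.Node00.Record11
import Literature.MathematicalPhysics.QuantumFieldTheory.Balaban1983to89.B12ContinuousTransportInvarianceOn
import Literature.MathematicalPhysics.QuantumLattice.GaugeGroupsProofs

/-!
# `Balaban1983to89.B16Thm1BaseAtRecord11` — YM-DAG node N13 · [Balaban1989LargeFieldII] CMP **122** (1989) 355–392, Theorem 1 p. 355 (its printed
# proof structure: induction on `k`, BASE = [Balaban1988Convergent] Thm 1 p. 262 «the initial density ρ₀ = exp[−(1∕g₀²)A − E]», STEP = §3 [III] (𝐓) then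
# [V] §1 (𝐑), p. 391 «This completes the proof of Theorem 1 and Corollary 3.») AT NODE 00's STAGE-11 RECORD `Node00.IsRecordOfRecord₁₁C` (`Node00/Record11`):
# the STEP reduces to the 𝐓-step law and the 𝐑-leaf of record; the BASE IS UNSATISFIABLE AS PINNED (located: the level-0 background map of record reads no
# configuration); the ONE-PIN REPAIR (print's `U₀ = U`) makes the base a theorem

statement-level bookkeeping over published theorems with citation tags; kernel-checked located negative + repair; nothing here is a claim about the Yang–Mills
mass gap.

CITATION HEADER (lean-in-tree rule).  Sources: T. Bałaban, *Large field renormalization. II*, Commun. Math. Phys. **122** (1989) 355–392 [Balaban1989LargeFieldII]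
(= [V]: Thm 1 p. 355, (0.1) pp. 355–356, p. 391); *Convergent renormalization expansions …*, Commun. Math. Phys. **119** (1988) 243–285 [Balaban1988Convergent] (= [III]:
Thm 1 p. 262 — the start `ρ₀`, (2.2) p. 255 — the determining set, (2.12) p. 256 — the background field, (2.17)–(2.18) p. 257, (2.23)–(2.24) pp. 258–259); *Renormalization
group approach … I*, Commun. Math. Phys. **109** (1987) 249–301 [Balaban1987RG1] (= [I]: (0.2) p. 252 the Wilson action).  Cell `pub-ymgap` (HUMAN RULING D-0062, Track A
full width), R134 acceleration seat `pub-ymgap-dag-n13-e` (prover; row of record: «Thm 1 p.355 + (0.1) construction pieces (`B16.Thm1Printed` :172) from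
`B16NodeKnitRepTower`∕`RecordPinned`»).  BY NAME and UNCHANGED: `…Node00.Record11` (p444286: `Stage11Params`, `Provisos₁₁`, `settingOfRecord₁₁`, `UbgOfRecord₁₁`,
`S218OfRecord₁₁`, `SLaw₁₁`, `TLaw₁₁`, `sLaw₁₁_iff`, `VOfRecord₁₁`, `rOpLeaf_VOfRecord₁₁_iff`, `HasSect2FormWithAE`, `HasSect2FormAE`, `datumOfRecord₁₁`, `flow_g_datumOfRecord₁₁`,
`IsRecordOfRecord₁₁C`), `…Node00.LargeFieldBackgroundOfRecord` (FILE 13: `UbgOfRecord`, `UbgOfRecord_apply`, `regLFOfRecord`), `…Node00.SmallFieldChiOfRecord` (`UminOfRecord`),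
`…Node00.RepTowerOfRecord` (FILE 2: `slotsOfRecord`), `…Node00.TStepOfRecord` (`texpAOfRecord_zero`, `chiSeqOfRecord_zero`), `…Node00.TkOfRecord` (11a: `TkOfRecord_zero`,
`Tk.baseCfg`), `…Node00.Sect2FormOfRecord` (11c: `sect2Slot`, `sect2Operand`, `Sect2.LawsRT.zero`), `…Node00.Sect2FrameOfRecord` (11b: `sect2ActionDataOfRecord`,
`Sect2.universalE_const`, `Sect2.TermValues.zero`), `…Node00.DatumAvLayer` (`rhoZeroOfRecord`), `…B15DeterminingSets` (r12: `genSet`, `gammaRegion`, `AgreeOn`, `IsMinimizer`),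
`…B14Eq218Concrete` (r11: `Seq`, `Seq.Ω_off`), `…B14Eq218SeqSucc` (`Seq.zero`), `…B14Eq225Concrete` (`smearedWilson_const`), `…B14LocalCoupling` (`invSq`),
`…B12ContinuousTransportInvariance(On)` (seat dag-n09-a: `isOpenPosMeasure_fieldMeasure_SU`, `continuous_plaqHol_SU`, the product topology `instTopologicalSpaceGaugeField`),
`…UnitaryModel` (`continuous_nReTr`), `QuantumLattice.GaugeGroups(Proofs)` (`fundamentalRep`, `exists_mul_ne_mul`, `reTr_le`, `eq_one_of_reTr_eq`), `…B14Cor3`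
(`inInterval_of_le`), `…B16` (`Thm1Printed` :172, `InductionBase` :1119, `InductionStep` :1129, `thm1_of_steps` :1135, `EndStatementBPrinted` :419), Mathlib
(`MeasureTheory.Measure.eq_of_ae_eq`).

WHY THIS FILE.  At Stage 11 the core's §2 clause `Sect2Form p k` IS `SLaw₁₁ θ p k` — the post-𝐑 slot family `slotsOfRecord … k` HAS THE §2 [III] FORM at index `k`
(`HasSect2FormAE`, identity read a.e. on the χ-support) at def-R's background maps of record `UbgOfRecord₁₁ θ p k` — so [V] Thm 1 at a Stage-11 datum reads
`B16.Thm1Printed (datumOfRecord₁₁ θ h).C ↔ ∃ γ > 0, ∀ P, InInterval γ P.K → ∀ k ≤ P.K, SLaw₁₁ θ P k`, and its printed proof is the induction `B16.thm1_of_steps`: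
BASE `SLaw₁₁ θ P 0` («ρ₀ = exp[−(1∕g₀²)A − E]» has the form (2.18) with no terms), STEP `SLaw₁₁ θ P k → SLaw₁₁ θ P (k+1)` = the 𝐓-step ([III] §3, Thm p. 245:
`SLaw₁₁ k → TLaw₁₁ k`, node N11's product) followed by the 𝐑-step ([V] Thm 1 for 𝐑 = the record's 𝐑-leaf `ROpLeaf (VOfRecord₁₁ θ P) ↔ ∀ k < K, TLaw₁₁ k → SLaw₁₁ (k+1)`,
`rOpLeaf_VOfRecord₁₁_iff`, node N13's `rOperation` conjunct).  §5 types the STEP in exactly that currency.  THE BASE, however, is UNSATISFIABLE AS PINNED (§§1–4):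

* (§1) an admissible sequence of LENGTH 0, `s : SeqOfRecord … 0`, has `s.Ω j = ∅` for every `j` (r11's normalisation `Seq.Ω_off`: print's sequences `{Ω_j}_{j=1}^k` are
  empty for `k = 0`), so the determining set of record `genSet s.Ω 0` ((2.2): `Γ₀ = Ω₀^{(0)}` in the `i = k` branch of `gammaRegion`) is EMPTY AT EVERY SCALE
  (`genSet_seq_zero`); the (2.12) constraint `AgreeOn (genSet s.Ω 0) …` is vacuous (`agreeOn_genSet_seq_zero`), the minimiser predicate does not read the retained
  configuration (`isMinimizer_seq_zero_iff`), and FILE 13's background map of record at length 0 — `UbgOfRecord … 0 s 𝐖 = UminOfRecord av reg (genSet s.Ω 0) 𝐖`,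
  a chosen unconstrained Wilson minimiser in the regularity class (a vacuum) or the junk unit — is THE SAME CONFIGURATION FOR EVERY `𝐖` (`UbgOfRecord_zero_const`).
  In print, at `k = 0` the background IS the field: `ρ₀(U) = exp[−(1∕g₀²)A(U) − E]` ([III] Thm 1 p. 262), `U₀ = U`.
* (§2) consequently every §2-form slot at level 0 over that background map, `sect2Slot … s t E_0 (UbgOfRecord₁₁ θ p 0 s)` — by 11a's `TkOfRecord_zero` the operand
  `exp A_0(U₀(𝐖))` read at the base configuration — is a CONSTANT function of `V₀` (`sect2Slot_zero_const`), whence a slot family of §2 form at level 0 is a.e. constant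
  on the χ-support (`hasSect2FormWithAE_zero_ae_eq_const`).
* (§3–§4) `χ₀ ≡ 1` (`chiSeqOfRecord_zero`) and the level-0 slot of record IS `ρ₀` (`texpAOfRecord_zero`), so `SLaw₁₁ θ p 0` forces `ρ₀ = e^{−E}·exp(−g₀^{−2}A)` to be
  a.e. CONSTANT for product Haar measure (`ae_eq_const_rhoZero_of_sLaw₁₁_zero`); `ρ₀` is continuous and product Haar measure on `SU(N)`-fields charges open sets
  (`isOpenPosMeasure_fieldMeasure_SU`, Mathlib `Measure.eq_of_ae_eq`), so the Wilson action would be CONSTANT once `g₀ ≠ 0` (`wilsonAction4_eq_of_ae_const_rhoZero`) —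
  false for `N ≥ 2` on every torus of the family (`exists_wilsonAction4_ne`: one bond carrying an element of `SU(N)` with `Re tr < N`).  Hence **`not_sLaw₁₁_zero`**:
  `2 ≤ N → gOfRecord₁₀ θ' p 0 ≠ 0 → ¬ SLaw₁₁ θ p 0`; and at the datum: `¬ Sect2Form 0` at every run with `g₀ ≠ 0`, **`¬ B16.InductionBase D.C γ`** as soon as ONE run lies
  in the `γ`-window, **`¬ B16.Thm1Printed D.C`** and **`¬ B16.EndStatementBPrinted D.C`** as soon as the record's runs enter every small coupling window (the non-vacuity
  window of the route's K1 item, `1 ≤ P.K` not even needed), for every Stage-11 record (`not_endStatementBPrinted_of_isRecordOfRecord₁₁C_of_window`), `N ≥ 2`.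
* (§6) THE REPAIR, PROVED: with the PRINT's level-0 background map `U₀ := 𝐖 ↦ 𝐖 0` (the scale-0 gauge variables themselves) the level-0 slot family of record HAS the
  §2 form at index 0 — pure slot, zero term values, `E_0(s) := E` of the run, since (2.24) at `k = 0` is the constant `1∕g₀²` (`invSq … 0`) and
  `A(1∕g₀², U) = g₀^{−2}A(U)` (`smearedWilson_const`, `wilsonAction_eq_mul`): **`hasSect2FormAE_zero_printedBackground`**, NO hypothesis.  So a successor record
  that pins `UbgOfRecord₁₁ θ p 0 := fun _ 𝐖 => 𝐖 0` (leaving every `k ≥ 1` as is; equivalently reads `S218OfRecord₁₁ θ p 0 σ` as the representation clause alone)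
  has the BASE as a THEOREM, and [V] Thm 1 at that record is `thm1_of_steps` ∘ (§6, §5) — i.e. EXACTLY the 𝐓-step law and the 𝐑-leaf along the runs in the window.

CONSEQUENCE FOR THE ROUTE (stated on the Summits side in `Theorems/BalabanUVNodesStabilityBR11e/Negative/…`, not here): K1 `StabilityBAtRecordR11e` (rev 6) asks
for a Stage-11 record with `EndStatementBPrinted D.C` AND the window, which §4 refutes at every record for `N = 2`; so K0 ∧ K1 are jointly unsatisfiable as typed and
K2's hypotheses are contradictory (vacuous as typed) — a LOCATED TYPING DEFECT of the Stage-11 pin at level 0 with a one-line repair, NOT a statement about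
Bałaban's theorem.

HONEST FRAMING.  Count-neutral kernel bookkeeping: a located negative about the tree's OWN objects of record and its repair; NOTHING of Bałaban's is asserted or
refuted — in print the base case is a triviality (ρ₀ has the form (2.18) with 𝐓₀ = 1, U₀ = U, no terms), and §6 proves exactly that triviality at the objects of
record under the print's reading of `U₀`.  §5's STEP hypotheses (the 𝐓-step law, the 𝐑-leaf) are [III] Thm p. 245 ∕ [V] Thm 1 at the objects of record, DISPLAYED,
owned by nodes N11 ∕ N13; no estimate is proved here; N13 is NOT discharged; counts unmoved (typed 28∕28 · discharged 5∕28).  One finite four-torus programme at fixed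
`ε`, Bałaban AS PRINTED with locators; nothing continuum ∕ ℝ⁴ ∕ OS ∕ mass gap ∕ Clay.  0 `def`, 0 `sorry`, standard axioms.
-/

noncomputable section

open MeasureTheory
open scoped Matrix.Norms.L2Operator

namespace Literature.MathematicalPhysics.QuantumFieldTheory.Balaban1983to89.B16Thm1BaseAtRecord11

open Node00 T4Continuum B14.Eq218Concrete B15DeterminingSets

variable (F : T4Family) (N : ℕ) [NeZero N]

/-! ## §1. The determining set and the background map of record AT LENGTH 0 (located: the map reads no configuration) -/

omit [NeZero N] in
/-- **At length 0 the determining set of record is EMPTY at every scale**: an admissible sequence `s` of length `0` has `s.Ω j = ∅` for all `j` (r11's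
normalisation off the window `1 ≤ j ≤ k`), and `genSet s.Ω 0 i = (gammaRegion s.Ω 0 i)^{(i)}` takes the `i = k = 0` branch `Ω₀ = ∅` (resp. `∅` above `k`).  Print
(2.2) p. 255: «Γ₀ = Ω₁ᶜ, …, Γ_k = Ω_k^{(k)}» is stated for `k ≥ 1`; at `k = 0` there is no sequence and the background is the field itself ([III] Thm 1 p. 262).
[cite: Balaban1988Convergent, (2.2) p.255 and Thm 1 p.262 (located typing divergence; bookkeeping)] -/
theorem genSet_seq_zero {ν : Stage7Numerics} {M : ℕ} {g : ℕ → ℝ} {K : ℕ} (s : SeqOfRecord F ν M g K 0) (j : ℕ) :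
    genSet s.Ω 0 j = ∅ := by
  have h0 : ∀ i, s.Ω i = ∅ := fun i => s.Ω_off i (by omega)
  unfold genSet gammaRegion
  ext x
  simp [h0]

omit [NeZero N] in
/-- Hence the (2.12) constraint «`M_𝐁(U) = 𝐖` on the determining set» of a length-0 sequence is VACUOUS: any two multi-scale configurations agree on it.
[cite: Balaban1988Convergent, (2.11)–(2.12) p.256 (bookkeeping at the empty determining set)] -/
theorem agreeOn_genSet_seq_zero {ν : Stage7Numerics} {M : ℕ} {g : ℕ → ℝ} {K : ℕ} (s : SeqOfRecord F ν M g K 0)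
    (V W : MSField (F.P K) (SU N)) : AgreeOn (genSet s.Ω 0) V W := by
  intro j b hb
  rw [genSet_seq_zero F s j] at hb
  simp [bondsOf] at hb

/-- So at length 0 the (2.12) minimiser predicate of record DOES NOT READ the retained configuration `𝐖`: `U₀` is a minimiser iff it is a regular configuration
minimising the Wilson action in the regularity class outright. [cite: Balaban1988Convergent, (2.12) p.256 (bookkeeping at the empty determining set)] -/
theorem isMinimizer_seq_zero_iff {ν : Stage7Numerics} {M : ℕ} {g : ℕ → ℝ} {K : ℕ} (s : SeqOfRecord F ν M g K 0)
    (reg : Set (GaugeField (F.P K) 0 (SU N))) (W : MSField (F.P K) (SU N)) (U₀ : GaugeField (F.P K) 0 (SU N)) :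
    IsMinimizer (avOfRecord F N K) reg (genSet s.Ω 0) W U₀ ↔ U₀ ∈ reg ∧ ∀ U, U ∈ reg → wilsonAction4 U₀ ≤ wilsonAction4 U :=
  ⟨fun h => ⟨h.1, fun U hU => h.2.2 U hU (agreeOn_genSet_seq_zero F N s _ _)⟩,
    fun h => ⟨h.1, agreeOn_genSet_seq_zero F N s _ _, fun U hU _ => h.2 U hU⟩⟩

/-- **THE LOCATED JUNK: def-R's background map of record AT LENGTH 0 IS A CONSTANT MAP** — `UbgOfRecord … 0 s 𝐖` (FILE 13: the total (2.12) solution map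
`UminOfRecord` on the determining set `genSet s.Ω 0 = ∅`) is the same configuration for every `𝐖` (a chosen unconstrained regular Wilson minimiser, or the junk unit):
it does not read the scale-0 gauge variables `𝐖 0 = V₀`, whereas print's level-0 background is `U₀ = U` itself ([III] Thm 1: `ρ₀(U) = exp[−(1∕g₀²)A(U) − E]`).
[cite: Balaban1988Convergent, (2.12) p.256 and Thm 1 p.262 (located typing divergence; bookkeeping)] -/
theorem UbgOfRecord_zero_const {ν : Stage7Numerics} {M : ℕ} {g : ℕ → ℝ} {K : ℕ} (s : SeqOfRecord F ν M g K 0)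
    (W W' : MSField (F.P K) (SU N)) :
    UbgOfRecord F N ν M g K 0 s W = UbgOfRecord F N ν M g K 0 s W' := by
  have h : IsMinimizer (avOfRecord F N K) (regLFOfRecord F N ν K 0) (genSet s.Ω 0) W =
      IsMinimizer (avOfRecord F N K) (regLFOfRecord F N ν K 0) (genSet s.Ω 0) W' := by
    funext U₀
    exact propext ((isMinimizer_seq_zero_iff F N s _ W U₀).trans (isMinimizer_seq_zero_iff F N s _ W' U₀).symm)
  rw [UbgOfRecord_apply, UbgOfRecord_apply]
  unfold UminOfRecord
  rw [h]

/-! ## §2. A §2-form slot at level 0 over a constant background map is a constant function of `V₀` -/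

omit [NeZero N] in
/-- At the base configuration of scale 0 (11a's `Tk.baseCfg`), the scale-0 gauge variables ARE `V₀`. [cite: Balaban1988Convergent, (2.20) p.258 (bookkeeping)] -/
theorem baseCfg_zero_fst {P : Params} (V0 : GaugeField P 0 (SU N)) :
    ((Tk.baseCfg (V := FluctV N) 0 V0) 0).1 = V0 := by
  funext b
  simp [Tk.baseCfg]

section Slot

variable (V : Type) [NormedAddCommGroup V] [InnerProductSpace ℝ V] [FiniteDimensional ℝ V] [MeasurableSpace V] [BorelSpace V]
  {𝔸 : Type*} [NormedRing 𝔸] [NormedAlgebra ℂ 𝔸] [CompleteSpace 𝔸]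

/-- **A §2-form slot at level 0 over a CONSTANT background map is a CONSTANT function of `V₀`**: by 11a's `k = 0` face `(𝐓₀Φ)(V₀) = Φ(∅-branch, A = 0, base
variables)` the slot `sect2Slot … s t E_0 U` at `V₀` is `exp A_0(U(𝐖₀(V₀)))`, and `U` does not read its argument. [cite: Balaban1988Convergent, (2.18) p.257, (2.20) p.258, (2.23) p.258 (bookkeeping)] -/
theorem sect2Slot_zero_const (K : ℕ) (S : Sect2.Setting 𝔸 (SU N)) (Rz : Sect2.Residual (F.P K) 𝔸) (Wt : TkWeights F N V K)
    {ν : Stage7Numerics} {M : ℕ} {g : ℕ → ℝ} (s : SeqOfRecord F ν M g K 0) (t : Sect2.TermValues (F.P K) 𝔸 V M) (Ek : ℝ)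
    (U : BgMap F N K) (hU : ∀ W W', U W = U W') (V₀ V₀' : GaugeField (F.P K) 0 (SU N)) :
    sect2Slot F N V K S Rz Wt s t Ek U V₀ = sect2Slot F N V K S Rz Wt s t Ek U V₀' := by
  simp only [sect2Slot, TkOfRecord_zero, sect2Operand, Tk.baseCfg_snd]
  rw [hU _ (fun j => ((Tk.baseCfg (V := V) 0 V₀') j).1)]

/-- **At level 0, a slot family of §2 form (identity a.e., 11d's `HasSect2FormWithAE`) over constant background maps is a.e. CONSTANT** on every sequence: the
identity holds on the χ-support and `χ₀ ≡ 1` (`chiSeqOfRecord_zero`). [cite: Balaban1988Convergent, (2.17)–(2.18) p.257, Thm 1 p.262 (bookkeeping)] -/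
theorem hasSect2FormWithAE_zero_ae_eq_const {K : ℕ} {S : Sect2.Setting 𝔸 (SU N)} {Rz : Sect2.Residual (F.P K) 𝔸} {Wt : TkWeights F N V K}
    {ν : Stage7Numerics} {M : ℕ} {g : ℕ → ℝ} {U : SeqOfRecord F ν M g K 0 → BgMap F N K}
    {law : SeqOfRecord F ν M g K 0 → Sect2.TermValues (F.P K) 𝔸 V M → Prop}
    {slot : SeqOfRecord F ν M g K 0 → Density (F.P K) 0 (SU N)}
    (h : HasSect2FormWithAE F N V K S Rz Wt 0 U law slot) (hU : ∀ s W W', U s W = U s W') (s : SeqOfRecord F ν M g K 0) :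
    ∃ c : ℝ, ∀ᵐ V₀ ∂(fieldMeasure (F.P K) 0 (SU N)), slot s V₀ = c := by
  obtain ⟨t, Ek, -, hs⟩ := h
  refine ⟨sect2Slot F N V K S Rz Wt s (t s) (Ek s) (U s) 1, ?_⟩
  filter_upwards [(hs s).2] with V₀ hV₀
  rw [hV₀ (by rw [chiSeqOfRecord_zero]; exact one_ne_zero)]
  exact sect2Slot_zero_const F N V K S Rz Wt s (t s) (Ek s) (U s) (hU s) V₀ 1

end Slot

/-! ## §3. Analysis and group bookkeeping: `ρ₀` is continuous, product Haar charges open sets, the Wilson action is not constant for `N ≥ 2` -/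

/-- The `d = 4` Wilson action `A(U) = Σ_p [1 − Re tr U(∂p)]` is continuous on `SU(N)`-valued configurations of any torus `T^{(j)}` (product topology).
[cite: Balaban1987RG1, (0.2) p.252 (bookkeeping)] -/
theorem continuous_wilsonAction4_SU (P : Params) (j : ℕ) : Continuous (wilsonAction4 : GaugeField P j (SU N) → ℝ) := by
  unfold wilsonAction4 wilsonAction
  have hre : Continuous (reTr : SU N → ℝ) :=
    UnitaryModel.continuous_nReTr.comp (Literature.MathematicalPhysics.QuantumLattice.continuous_fundamentalRep (Fin N))
  refine continuous_finsetSum _ fun p _ => continuous_const.mul (continuous_const.sub ?_)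
  exact hre.comp (B12ContinuousTransportInvarianceOn.continuous_plaqHol_SU p)

/-- The start density of record `ρ₀ = e^{−E}·exp(−g₀^{−2}A)` is continuous. [cite: Balaban1988Convergent, Thm 1 p.262 (bookkeeping)] -/
theorem continuous_rhoZeroOfRecord (K : ℕ) (g₀ E : ℝ) : Continuous (rhoZeroOfRecord F N K g₀ E) := by
  unfold rhoZeroOfRecord Missing.boltzmann
  exact continuous_const.mul (Real.continuous_exp.comp (continuous_const.mul (continuous_wilsonAction4_SU N _ 0)))

/-- **If `ρ₀` is a.e. equal to a constant for product Haar measure and `g₀ ≠ 0`, the Wilson action is constant**: `ρ₀` is continuous and product Haar measure on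
`SU(N)`-valued fields charges every non-empty open set (`isOpenPosMeasure_fieldMeasure_SU`), so the a.e. identity is an identity (Mathlib `Measure.eq_of_ae_eq`), and
`e^{−E} ≠ 0`, `exp` injective, `g₀^{−2} ≠ 0`. [cite: Balaban1988Convergent, Thm 1 p.262 (bookkeeping); Balaban1985Averaging, (10) p.19] -/
theorem wilsonAction4_eq_of_ae_const_rhoZero (K : ℕ) {g₀ : ℝ} (hg₀ : g₀ ≠ 0) (E c : ℝ)
    (h : ∀ᵐ V₀ ∂(fieldMeasure (F.P K) 0 (SU N)), rhoZeroOfRecord F N K g₀ E V₀ = c)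
    (U U' : GaugeField (F.P K) 0 (SU N)) : wilsonAction4 U = wilsonAction4 U' := by
  haveI := B12ContinuousTransportInvariance.isOpenPosMeasure_fieldMeasure_SU N (F.P K) 0
  have hfun : rhoZeroOfRecord F N K g₀ E = fun _ => c :=
    Measure.eq_of_ae_eq h (continuous_rhoZeroOfRecord F N K g₀ E) continuous_const
  have hUU' : rhoZeroOfRecord F N K g₀ E U = rhoZeroOfRecord F N K g₀ E U' := by rw [hfun]
  unfold rhoZeroOfRecord Missing.boltzmann at hUU'
  have h1 := mul_left_cancel₀ (Real.exp_ne_zero _) hUU'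
  have h2 := Real.exp_injective h1
  have hβ : (g₀⁻¹ ^ 2 : ℝ) ≠ 0 := pow_ne_zero _ (inv_ne_zero hg₀)
  have h3 : g₀⁻¹ ^ 2 * wilsonAction4 U = g₀⁻¹ ^ 2 * wilsonAction4 U' := by linarith
  exact mul_left_cancel₀ hβ h3

/-- The interface `reTr` on `SU(N)` IS `Re Tr ∕ N` of the matrix (unfolding of the `UnitaryModel` instance through `fundamentalRep`). [cite: Balaban1987RG1, (0.2) p.252 («tr 1 = 1»; bookkeeping)] -/
theorem reTr_SU_eq (u : SU N) : (reTr u : ℝ) = (Matrix.trace (u : Matrix (Fin N) (Fin N) ℂ)).re / N := by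
  show UnitaryModel.nReTr (Literature.MathematicalPhysics.QuantumLattice.fundamentalRep (Fin N) u) = _
  simp [UnitaryModel.nReTr]

/-- For `N ≥ 2` some element of `SU(N)` has normalised real trace `< 1` (`SU(N)` is non-abelian, hence non-trivial; `Re tr u = N` only at `u = 1` — the tree's
`QuantumLattice.exists_mul_ne_mul`, `reTr_le`, `eq_one_of_reTr_eq`; Bröcker–tom Dieck IV (3.1): the maximal torus of `SU(n)`, `n ≥ 2`, is non-trivial). [cite: BrockerTomDieck1985, IV (3.1)] -/
theorem exists_reTr_lt_one (hN : 2 ≤ N) : ∃ u : SU N, reTr u < 1 := by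
  obtain ⟨a, b, hab⟩ := Literature.MathematicalPhysics.QuantumLattice.exists_mul_ne_mul (n := Fin N) (by simpa using hN)
  have ha : a ≠ 1 := by rintro rfl; exact hab (by rw [one_mul, mul_one])
  haveI : Nonempty (Fin N) := ⟨⟨0, by omega⟩⟩
  have hlt : Literature.MathematicalPhysics.QuantumLattice.reTr a < Fintype.card (Fin N) :=
    lt_of_le_of_ne (Literature.MathematicalPhysics.QuantumLattice.reTr_le a)
      (fun h => ha (Literature.MathematicalPhysics.QuantumLattice.eq_one_of_reTr_eq a h))
  refine ⟨a, ?_⟩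
  rw [reTr_SU_eq]
  have hN' : (0 : ℝ) < N := by exact_mod_cast (show 0 < N by omega)
  rw [div_lt_one hN']
  simpa [Literature.MathematicalPhysics.QuantumLattice.reTr] using hlt

omit [NeZero N] in
/-- `A(1) = 0` for the unit configuration (`1(∂p) = 1`, `Re tr 1 = 1`). [cite: Balaban1987RG1, (0.2) p.252 (bookkeeping)] -/
theorem wilsonAction4_unit {P : Params} {j : ℕ} {G : Type*} [GaugeGroup G] :
    wilsonAction4 (1 : GaugeField P j G) = 0 := by
  unfold wilsonAction4 wilsonAction
  refine Finset.sum_eq_zero fun p _ => ?_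
  have : GaugeField.plaqHol (1 : GaugeField P j G) p = 1 := by
    show (1 : G) * 1 * 1⁻¹ * 1⁻¹ = 1
    simp
  rw [this, GaugeGroup.reTr_one]; ring

/-- **On every torus of the family the Wilson action is NOT constant on `SU(N)`-valued configurations, `N ≥ 2`**: the configuration carrying an element `u` with
`Re tr u < 1` on the single bond `⟨0, e₀⟩` and `1` elsewhere has the plaquette `⟨0; e₀, e₁⟩` equal to `u` (its other three bonds are distinct from `⟨0, e₀⟩`: the
directions differ, or `0 + e₁ ≠ 0` since `T^{(0)}` has `2L^{m+K} ≥ 2` sites per direction), hence `A > 0 = A(1)`. [cite: Balaban1987RG1, (0.1)–(0.2) pp.251–252 (bookkeeping)] -/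
theorem exists_wilsonAction4_ne (hN : 2 ≤ N) (K : ℕ) :
    ∃ U U' : GaugeField (F.P K) 0 (SU N), wilsonAction4 U ≠ wilsonAction4 U' := by
  classical
  obtain ⟨u, hu⟩ := exists_reTr_lt_one N hN
  let μ0 : Fin (F.P K).d := ⟨0, by simp⟩
  let ν1 : Fin (F.P K).d := ⟨1, by simp⟩
  let x₀ : Site (F.P K) 0 := fun _ => 0
  let b₀ : PBond (F.P K) 0 := ⟨x₀, μ0⟩
  let U : PBond (F.P K) 0 → SU N := fun b => if b = b₀ then u else 1
  let p₀ : Plaq (F.P K) 0 := ⟨x₀, μ0, ν1, by show (0 : ℕ) < 1; omega⟩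
  have hshift : x₀.shift ν1 ≠ x₀ := by
    intro h
    have h1 := congrFun h ν1
    simp only [Site.shift, Function.update_self, x₀, zero_add] at h1
    have hn : 1 < (F.P K).sitesPerDir 0 := by
      unfold Params.sitesPerDir
      have := (F.P K).L_pos
      have : 1 ≤ (F.P K).L ^ ((F.P K).m + (F.P K).K - 0) := Nat.one_le_pow _ _ this
      omega
    haveI : Fact (1 < (F.P K).sitesPerDir 0) := ⟨hn⟩
    exact one_ne_zero h1
  have hdir : ν1 ≠ μ0 := fun h => by have := congrArg Fin.val h; simp [μ0, ν1] at this
  have hne1 : (⟨x₀.shift μ0, ν1⟩ : PBond (F.P K) 0) ≠ b₀ := fun h => hdir (PBond.mk.inj h).2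
  have hne2 : (⟨x₀.shift ν1, μ0⟩ : PBond (F.P K) 0) ≠ b₀ := fun h => hshift (PBond.mk.inj h).1
  have hne3 : (⟨x₀, ν1⟩ : PBond (F.P K) 0) ≠ b₀ := fun h => hdir (PBond.mk.inj h).2
  have hU0 : U b₀ = u := if_pos rfl
  have hU1 : U ⟨x₀.shift μ0, ν1⟩ = 1 := if_neg hne1
  have hU2 : U ⟨x₀.shift ν1, μ0⟩ = 1 := if_neg hne2
  have hU3 : U ⟨x₀, ν1⟩ = 1 := if_neg hne3
  have hpl : GaugeField.plaqHol (U : GaugeField (F.P K) 0 (SU N)) p₀ = u := by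
    show U ⟨x₀, μ0⟩ * U ⟨x₀.shift μ0, ν1⟩ * (U ⟨x₀.shift ν1, μ0⟩)⁻¹ * (U ⟨x₀, ν1⟩)⁻¹ = u
    rw [show (⟨x₀, μ0⟩ : PBond (F.P K) 0) = b₀ from rfl, hU0, hU1, hU2, hU3]
    simp
  have hpos : 0 < wilsonAction4 (U : GaugeField (F.P K) 0 (SU N)) := by
    unfold wilsonAction4 wilsonAction
    refine lt_of_lt_of_le ?_ (Finset.single_le_sum
      (f := fun p => (1 : ℝ) * (1 - reTr (GaugeField.plaqHol (U : GaugeField (F.P K) 0 (SU N)) p)))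
      (fun p _ => ?_) (Finset.mem_univ p₀))
    · rw [hpl]; linarith
    · have := GaugeGroup.reTr_le_one (GaugeField.plaqHol (U : GaugeField (F.P K) 0 (SU N)) p); linarith
  exact ⟨U, 1, by rw [wilsonAction4_unit]; exact ne_of_gt hpos⟩

/-! ## §4. AT THE STAGE-11 RECORD: the base of [V] Thm 1 is unsatisfiable as pinned; consequences for `InductionBase`, `Thm1Printed`, `EndStatementBPrinted` -/

section AtRecord

variable (θ : Stage11Params F N) (p : B12.RunParams)

/-- **`SLaw₁₁ θ p 0` FORCES `ρ₀` TO BE a.e. CONSTANT**: the level-0 format law of record (`sLaw₁₁_iff`: the post-𝐑 slot family at level 0 — which IS `ρ₀` on the one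
length-0 sequence, `texpAOfRecord_zero` — has the §2 form at def-R's background maps of record, identity a.e. on the χ-support, `χ₀ ≡ 1`) gives, by §§1–2, a
constant `c` with `ρ₀ = c` for product-Haar-a.e. `V₀`. [cite: Balaban1988Convergent, Thm 1 p.262, (2.18) p.257 (bookkeeping over the tree's pin)] -/
theorem ae_eq_const_rhoZero_of_sLaw₁₁_zero (h : SLaw₁₁ F N θ p 0) :
    ∃ c : ℝ, ∀ᵐ V₀ ∂(fieldMeasure (F.P p.K) 0 (SU N)),
      rhoZeroOfRecord F N p.K (gOfRecord₁₀ F N θ.toStage9Params p 0) (EOfRecord₁₀ F N θ.toStage9Params p) V₀ = c :=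
  hasSect2FormWithAE_zero_ae_eq_const F N (FluctV N) ((sLaw₁₁_iff F N θ p 0).mp h)
    (fun s W W' => UbgOfRecord_zero_const F N s W W') (Seq.zero _)

/-- **THE BASE OF [V] THEOREM 1 IS UNSATISFIABLE AS PINNED AT STAGE 11**: for `N ≥ 2` and a run whose bare coupling of record is non-zero, `¬ SLaw₁₁ θ p 0` — else the
Wilson action of the torus `T^{(0)}` would be constant (§3).  LOCATED: the level-0 background map of record is constant (§1); the repair is §6.
[cite: Balaban1988Convergent, Thm 1 p.262 (the printed base «ρ₀ = exp[−(1∕g₀²)A − E]», against the tree's level-0 pin); Balaban1989LargeFieldII, Thm 1 p.355] -/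
theorem not_sLaw₁₁_zero (hN : 2 ≤ N) (hg : gOfRecord₁₀ F N θ.toStage9Params p 0 ≠ 0) : ¬ SLaw₁₁ F N θ p 0 := fun h => by
  obtain ⟨c, hc⟩ := ae_eq_const_rhoZero_of_sLaw₁₁_zero F N θ p h
  obtain ⟨U, U', hUU'⟩ := exists_wilsonAction4_ne F N hN p.K
  exact hUU' (wilsonAction4_eq_of_ae_const_rhoZero F N p.K hg _ c hc U U')

variable (h : θ.Provisos₁₁)

/-- At the Stage-11 datum the construction's §2 clause at step 0 FAILS on every run with non-zero bare coupling (the clause IS `SLaw₁₁ θ P 0`, `sect2Form_stage11_iff`).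
[cite: Balaban1989LargeFieldII, Thm 1 p.355; Balaban1988Convergent, Thm 1 p.262 (bookkeeping)] -/
theorem not_sect2Form_zero_datumOfRecord₁₁ (hN : 2 ≤ N) (P : B12.RunParams) (hg : ((datumOfRecord₁₁ F N θ h).C P).flow.g 0 ≠ 0) :
    ¬ ((datumOfRecord₁₁ F N θ h).C P).Sect2Form 0 :=
  fun hS => not_sLaw₁₁_zero F N θ P hN hg ((sLaw₁₁_iff F N θ P 0).mpr ((sect2Form_stage11_iff F N θ h P 0).mp hS))

/-- **`¬ B16.InductionBase` at the Stage-11 datum as soon as ONE run lies in the `γ`-window** (there `g₀ > 0`): the base case of [V] Thm 1's printed induction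
(`B16.InductionBase` :1119, [III] Thm 1 p. 262) is unsatisfiable at the objects of record as pinned. [cite: Balaban1988Convergent, Thm 1 p.262; Balaban1989LargeFieldII, Thm 1 p.355 (bookkeeping)] -/
theorem not_inductionBase_datumOfRecord₁₁ (hN : 2 ≤ N) {γ : ℝ}
    (hrun : ∃ P : B12.RunParams, ((datumOfRecord₁₁ F N θ h).C P).flow.InInterval γ P.K) :
    ¬ B16.InductionBase (datumOfRecord₁₁ F N θ h).C γ := fun hb => by
  obtain ⟨P, hP⟩ := hrun
  exact not_sect2Form_zero_datumOfRecord₁₁ F N θ h hN P (ne_of_gt (hP 0 (Nat.zero_le _)).1) (hb P hP)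

/-- **`¬ B16.Thm1Printed` AT EVERY STAGE-11 DATUM WHOSE RUNS ENTER EVERY SMALL COUPLING WINDOW** (`N ≥ 2`): whatever `γ > 0` Theorem 1's conclusion is read with, some
run lies in the `min(γ, γ₁)`-window (`B14Cor3.inInterval_of_le`), and there the step-0 clause fails.  The window hypothesis is the route's K1 non-vacuity clause WITHOUT
`1 ≤ P.K`. [cite: Balaban1989LargeFieldII, Thm 1 p.355 (as pinned at the tree's Stage-11 record; located negative)] -/
theorem not_thm1Printed_datumOfRecord₁₁_of_window (hN : 2 ≤ N)
    (hwin : ∃ γ₁ : ℝ, 0 < γ₁ ∧ ∀ γ : ℝ, 0 < γ → γ ≤ γ₁ →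
      ∃ P : B12.RunParams, ((datumOfRecord₁₁ F N θ h).C P).flow.InInterval γ P.K) :
    ¬ B16.Thm1Printed (datumOfRecord₁₁ F N θ h).C := by
  rintro ⟨γ, hγ, hall⟩
  obtain ⟨γ₁, hγ₁, hw⟩ := hwin
  obtain ⟨P, hP⟩ := hw (min γ γ₁) (lt_min hγ hγ₁) (min_le_right _ _)
  have hP' : ((datumOfRecord₁₁ F N θ h).C P).flow.InInterval γ P.K := B14Cor3.inInterval_of_le hP (min_le_left _ _)
  exact not_sect2Form_zero_datumOfRecord₁₁ F N θ h hN P (ne_of_gt (hP' 0 (Nat.zero_le _)).1) (hall P hP' 0 (Nat.zero_le _))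

/-- Hence `¬ B16.EndStatementBPrinted` (= Thm 1 ∧ [III] Cor. 3, the pin (B)) at every such Stage-11 datum. [cite: Balaban1989LargeFieldII, Thm 1 p.355 + p.391 (as pinned; located negative)] -/
theorem not_endStatementBPrinted_datumOfRecord₁₁_of_window (hN : 2 ≤ N)
    (hwin : ∃ γ₁ : ℝ, 0 < γ₁ ∧ ∀ γ : ℝ, 0 < γ → γ ≤ γ₁ →
      ∃ P : B12.RunParams, ((datumOfRecord₁₁ F N θ h).C P).flow.InInterval γ P.K) :
    ¬ B16.EndStatementBPrinted (datumOfRecord₁₁ F N θ h).C :=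
  fun hB => not_thm1Printed_datumOfRecord₁₁_of_window F N θ h hN hwin hB.1

end AtRecord

/-- **AT THE C-BINDING OF RECORD**: for every Stage-11 record `(D, w)` (`IsRecordOfRecord₁₁C`) whose runs enter every small coupling window, the pin (B)
`B16.EndStatementBPrinted D.C` FAILS, `N ≥ 2` — so «record ∧ (B) ∧ window», the consequent of the route's K1 item at Stage 11, is UNSATISFIABLE as typed.
[cite: Balaban1989LargeFieldII, Thm 1 p.355 + p.391 (as pinned at the tree's Stage-11 record; located negative)] -/
theorem not_endStatementBPrinted_of_isRecordOfRecord₁₁C_of_window (hN : 2 ≤ N) {D : FiniteEpsData F (SU N)} {w : DagBinding.WorldP}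
    (hrec : IsRecordOfRecord₁₁C F N D w)
    (hwin : ∃ γ₁ : ℝ, 0 < γ₁ ∧ ∀ γ : ℝ, 0 < γ → γ ≤ γ₁ → ∃ P : B12.RunParams, (D.C P).flow.InInterval γ P.K) :
    ¬ B16.EndStatementBPrinted D.C := by
  obtain ⟨θ, h, -, rfl, -⟩ := hrec
  exact not_endStatementBPrinted_datumOfRecord₁₁_of_window F N θ h hN hwin

/-- The same as ONE implication «record → (B) → window → False» (the shape the route's K2 item's hypotheses have). [cite: Balaban1989LargeFieldII, Thm 1 p.355 + p.391 (as pinned; located negative)] -/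
theorem false_of_isRecordOfRecord₁₁C_endStatementB_window (hN : 2 ≤ N) {D : FiniteEpsData F (SU N)} {w : DagBinding.WorldP}
    (hrec : IsRecordOfRecord₁₁C F N D w) (hB : B16.EndStatementBPrinted D.C)
    (hwin : ∃ γ₁ : ℝ, 0 < γ₁ ∧ ∀ γ : ℝ, 0 < γ → γ ≤ γ₁ → ∃ P : B12.RunParams, 1 ≤ P.K ∧ (D.C P).flow.InInterval γ P.K) :
    False :=
  not_endStatementBPrinted_of_isRecordOfRecord₁₁C_of_window F N hN hrec
    (by obtain ⟨γ₁, hγ₁, hw⟩ := hwin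
        exact ⟨γ₁, hγ₁, fun γ hγ hγ' => by obtain ⟨P, -, hP⟩ := hw γ hγ hγ'; exact ⟨P, hP⟩⟩) hB

/-! ## §5. THE STEP of [V] Thm 1's printed induction at the Stage-11 record: 𝐓-step law + 𝐑-leaf (the seat's row: Thm 1's construction pieces, by name) -/

section Step

variable (θ : Stage11Params F N) (h : θ.Provisos₁₁)

/-- **THE STEP OF THEOREM 1 AT THE OBJECTS OF RECORD** ([V] p. 390–391 «the result 𝐑ρ_k of the 𝐑-operation can be written in the form (2.18) [III], with all the
expressions satisfying the induction hypothesis»; `B16.InductionStep` :1129): along every run in the `γ`-window, from the 𝐓-STEP LAW «`ρ_k` of §2 form ⇒ `𝐓ρ_k` of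
𝐓-image form» (`SLaw₁₁ k → TLaw₁₁ k`, [III] Thm p. 245 ∕ §3 — node N11's product) and the 𝐑-LEAF of record `ROpLeaf (VOfRecord₁₁ θ P)` (= «`TLaw₁₁ k → SLaw₁₁ (k+1)`,
`k < K`», `rOpLeaf_VOfRecord₁₁_iff` — [V] Thm 1 for 𝐑, node N13's `rOperation` conjunct).  Both hypotheses DISPLAYED. [cite: Balaban1989LargeFieldII, Thm 1 p.355 and pp.390–391; Balaban1988Convergent, Thm p.245, Thm 2 p.263] -/
theorem inductionStep_datumOfRecord₁₁_of_tLaw_rOpLeaf (γ : ℝ)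
    (hT : ∀ P : B12.RunParams, ((datumOfRecord₁₁ F N θ h).C P).flow.InInterval γ P.K →
      ∀ k, k < P.K → SLaw₁₁ F N θ P k → TLaw₁₁ F N θ P k)
    (hR : ∀ P : B12.RunParams, ((datumOfRecord₁₁ F N θ h).C P).flow.InInterval γ P.K → DagBinding.ROpLeaf (VOfRecord₁₁ F N θ P)) :
    B16.InductionStep (datumOfRecord₁₁ F N θ h).C γ := by
  intro P hP k hk hS
  have hS' : SLaw₁₁ F N θ P k := (sLaw₁₁_iff F N θ P k).mpr ((sect2Form_stage11_iff F N θ h P k).mp hS)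
  exact (sect2Form_stage11_iff F N θ h P (k + 1)).mpr
    ((sLaw₁₁_iff F N θ P (k + 1)).mp ((rOpLeaf_VOfRecord₁₁_iff F N θ P).mp (hR P hP) k hk (hT P hP k hk hS')))

/-- **[V] THEOREM 1 AT THE STAGE-11 DATUM FROM ITS PRINTED PIECES** (`B16.thm1_of_steps`): BASE + 𝐓-step law + 𝐑-leaf along the runs in the `γ`-window.  CAVEAT OF
RECORD (§4): the BASE `B16.InductionBase (datumOfRecord₁₁ θ h).C γ` is UNSATISFIABLE as pinned as soon as one run lies in the `γ`-window (`N ≥ 2`) — this theorem is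
the shape a successor record with the §6 repair inherits, where the base is the theorem `hasSect2FormAE_zero_printedBackground`. [cite: Balaban1989LargeFieldII, Thm 1 p.355 + p.391; Balaban1988Convergent, Thm 1 p.262] -/
theorem thm1Printed_datumOfRecord₁₁_of_base_tLaw_rOpLeaf {γ : ℝ} (hγ : 0 < γ)
    (hbase : B16.InductionBase (datumOfRecord₁₁ F N θ h).C γ)
    (hT : ∀ P : B12.RunParams, ((datumOfRecord₁₁ F N θ h).C P).flow.InInterval γ P.K →
      ∀ k, k < P.K → SLaw₁₁ F N θ P k → TLaw₁₁ F N θ P k)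
    (hR : ∀ P : B12.RunParams, ((datumOfRecord₁₁ F N θ h).C P).flow.InInterval γ P.K → DagBinding.ROpLeaf (VOfRecord₁₁ F N θ P)) :
    B16.Thm1Printed (datumOfRecord₁₁ F N θ h).C :=
  B16.thm1_of_steps _ γ hγ hbase (inductionStep_datumOfRecord₁₁_of_tLaw_rOpLeaf F N θ h γ hT hR)

end Step

/-! ## §6. THE REPAIR: with the print's level-0 background `U₀ = U` the base HOLDS at the objects of record -/

omit [NeZero N] in
/-- `wilsonAction w = w · wilsonAction4`. [cite: Balaban1987RG1, (0.2) p.252 (bookkeeping)] -/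
theorem wilsonAction_eq_mul {P : Params} {j : ℕ} {G : Type*} [GaugeGroup G] (w : ℝ) (U : GaugeField P j G) :
    wilsonAction w U = w * wilsonAction4 U := by
  unfold wilsonAction4 wilsonAction
  rw [Finset.mul_sum]
  simp

omit [NeZero N] in
/-- (2.23) at `k = 0` has no term sums: `A_0(U) = −A(1∕g_0²(·), U) − E_0`. [cite: Balaban1988Convergent, (2.23) p.258] -/
theorem action23_zero {P : Params} {G : Type*} [GaugeGroup G] {Φ 𝒢 𝔄 : Type*} {T : Step.LFTower P G Φ 𝒢 𝔄}
    (D : Step.LFActionData P G T) (U : GaugeField P 0 G) : D.action23 0 U = -D.wilsonLocal U - D.Econst := by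
  simp [Step.LFActionData.action23]

section Repair

variable (V : Type) [NormedAddCommGroup V] [InnerProductSpace ℝ V] [FiniteDimensional ℝ V] [MeasurableSpace V] [BorelSpace V]
  {𝔸 : Type*} [NormedRing 𝔸] [NormedAlgebra ℂ 𝔸] [CompleteSpace 𝔸]

omit [NormedAddCommGroup V] [InnerProductSpace ℝ V] [FiniteDimensional ℝ V] [MeasurableSpace V] [BorelSpace V] in
/-- The bare Wilson term of the (2.23) data of record is `A(1∕g_k²(·), ·)` with the local coupling (2.24), and its constant is `E_k` (`rfl` through 11b's
`Sect2.actionDataOfTerms` = `B14.Eq225Concrete.concrete`). [cite: Balaban1988Convergent, (2.23)–(2.24) pp.258–259 (bookkeeping)] -/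
theorem wilsonLocal_sect2ActionDataOfRecord (K : ℕ) (S : Sect2.Setting 𝔸 (SU N)) (Rz : Sect2.Residual (F.P K) 𝔸)
    {ν : Stage7Numerics} {M : ℕ} {g : ℕ → ℝ} {k : ℕ} (s : SeqOfRecord F ν M g K k) (t : Sect2.TermValues (F.P K) 𝔸 V M)
    (a : Tk.SFluct (F.P K) V) (Ek : ℝ) :
    (sect2ActionDataOfRecord F N V K S Rz s t a Ek).wilsonLocal = B14.Eq225Concrete.smearedWilson (B14.LocalCoupling.invSq S.flow Rz.phi k) ∧
      (sect2ActionDataOfRecord F N V K S Rz s t a Ek).Econst = Ek :=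
  ⟨rfl, rfl⟩

end Repair

/-- **THE REPAIRED BASE, PROVED**: with the PRINT's level-0 background map `U₀(𝐖) := 𝐖 0` (the scale-0 gauge variables themselves — [III] Thm 1 p. 262: at `k = 0`
there is no sequence, `𝐓₀ = 1` and the background is the field) the level-0 slot family of record `slotsOfRecord … 0` (= `ρ₀` on the one length-0 sequence) HAS THE
§2 [III] FORM at index 0 at the Stage-11 setting, residual data and weights of ANY `θ`: zero term values (universal 𝐄 trivially; the inductive assumptions at index 0
are empty, `Sect2.LawsRT.zero`), constant `E_0(s) := E` of the run, and the identity `ρ₀(V₀) = exp[−A(1∕g₀²(·), V₀) − E]` holds at EVERY `V₀` because (2.24) at `k = 0`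
is the constant `1∕g₀²` and `A(1∕g₀², U) = g₀^{−2}A(U)`.  NO hypothesis: this is what the base case says in print, at the objects of record, under the print's `U₀`.
[cite: Balaban1988Convergent, Thm 1 p.262, (2.18) p.257, (2.23)–(2.24) pp.258–259] -/
theorem hasSect2FormAE_zero_printedBackground (θ : Stage11Params F N) (p : B12.RunParams) :
    HasSect2FormAE F N (FluctV N) p.K (settingOfRecord₁₁ F N θ p) (θ.Rz p.K) (θ.Wt p.K) 0
      (fun _ W => W 0)
      (slotsOfRecord F N θ.ν θ.τ9 (EOfRecord₁₀ F N θ.toStage9Params) (wOfRecord₉ F N θ.toStage9Params) θ.ppSel p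
        (gOfRecord₁₀ F N θ.toStage9Params p) 0) := by
  refine ⟨fun _ => Sect2.TermValues.zero, fun _ => EOfRecord₁₀ F N θ.toStage9Params p, Sect2.universalE_const _, fun s => ⟨?_, ?_⟩⟩
  · exact Sect2.LawsRT.zero _ _
  · refine Filter.Eventually.of_forall fun V₀ _ => ?_
    rw [show slotsOfRecord F N θ.ν θ.τ9 (EOfRecord₁₀ F N θ.toStage9Params) (wOfRecord₉ F N θ.toStage9Params) θ.ppSel p
        (gOfRecord₁₀ F N θ.toStage9Params p) 0 s V₀ =
        rhoZeroOfRecord F N p.K (gOfRecord₁₀ F N θ.toStage9Params p 0) (EOfRecord₁₀ F N θ.toStage9Params p) V₀ from rfl]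
    simp only [sect2Slot, TkOfRecord_zero, sect2Operand, Tk.baseCfg_snd, baseCfg_zero_fst, action23_zero,
      (wilsonLocal_sect2ActionDataOfRecord F N (FluctV N) p.K _ _ s _ _ _).1,
      (wilsonLocal_sect2ActionDataOfRecord F N (FluctV N) p.K _ _ s _ _ _).2]
    rw [show B14.LocalCoupling.invSq (settingOfRecord₁₁ F N θ p).flow (θ.Rz p.K).phi 0 =
        fun _ => 1 / (gOfRecord₁₀ F N θ.toStage9Params p 0) ^ 2 from rfl]
    rw [B14.Eq225Concrete.smearedWilson_const, wilsonAction_eq_mul, rhoZeroOfRecord, Missing.boltzmann, ← Real.exp_add]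
    congr 1
    rw [inv_pow, one_div]
    ring

/-- **WITH THE REPAIRED LEVEL-0 BACKGROUND, [V] THEOREM 1's BASE IS A THEOREM along every run** — the `HasSect2FormAE` clause a successor record would pin at `j = 0`
(reading `UbgOfRecord₁₁ θ p 0` as `𝐖 ↦ 𝐖 0`) holds for every `θ` and `p`, so the base contributes NO hypothesis to `thm1_of_steps`; the STEP (§5) is then the whole
content: the 𝐓-step law (N11) and the 𝐑-leaf (N13). [cite: Balaban1988Convergent, Thm 1 p.262; Balaban1989LargeFieldII, Thm 1 p.355 + p.391] -/
theorem repairedBase_forall (θ : Stage11Params F N) :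
    ∀ p : B12.RunParams,
      HasSect2FormAE F N (FluctV N) p.K (settingOfRecord₁₁ F N θ p) (θ.Rz p.K) (θ.Wt p.K) 0 (fun _ W => W 0)
        (slotsOfRecord F N θ.ν θ.τ9 (EOfRecord₁₀ F N θ.toStage9Params) (wOfRecord₉ F N θ.toStage9Params) θ.ppSel p
          (gOfRecord₁₀ F N θ.toStage9Params p) 0) :=
  fun p => hasSect2FormAE_zero_printedBackground F N θ p

/-! ## §7. (v1.1) GENERIC FACES FOR SUCCESSOR RECORDS — any setting, residual data, weights and level-0 background map (for NODE 00's Stage-12 re-pin and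
the referee's slot-by-slot sweep): the level-0 verdict depends ONLY on whether the background map reads the scale-0 variables -/

section Generic

variable (V : Type) [NormedAddCommGroup V] [InnerProductSpace ℝ V] [FiniteDimensional ℝ V] [MeasurableSpace V] [BorelSpace V]
  {𝔸 : Type*} [NormedRing 𝔸] [NormedAlgebra ℂ 𝔸] [CompleteSpace 𝔸]

omit [NeZero N] [NormedAddCommGroup V] [InnerProductSpace ℝ V] [FiniteDimensional ℝ V] [MeasurableSpace V] [BorelSpace V] in
/-- At the base configuration of scale 0 the scale-0 gauge variables ARE `V₀` — generic fluctuation space (v1.1 twin of `baseCfg_zero_fst`).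
[cite: Balaban1988Convergent, (2.20) p.258 (bookkeeping)] -/
theorem fst_baseCfg_zero [Zero V] {P : Params} (V0 : GaugeField P 0 (SU N)) : ((Tk.baseCfg (V := V) 0 V0) 0).1 = V0 := by
  funext b
  simp [Tk.baseCfg]

/-- The level-0 slot of record is `ρ₀ > 0`, in particular NOT the zero function (so a «slot = 0 ∨ identity» dichotomy pin reduces, at level 0, to the identity).
[cite: Balaban1988Convergent, Thm 1 p.262 (bookkeeping)] -/
theorem slotsOfRecord_zero_pos (ν : Stage7Numerics) (τ : TowerNumerics) (E : B12.RunParams → ℝ) (w : StepWeightsOfRecord F N ν τ.M)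
    (ppSel : PpSelOfRecord F ν τ.M) (p : B12.RunParams) (g : ℕ → ℝ) (s : SeqOfRecord F ν τ.M g p.K 0) (V₀ : GaugeField (F.P p.K) 0 (SU N)) :
    0 < slotsOfRecord F N ν τ E w ppSel p g 0 s V₀ :=
  rhoZeroOfRecord_pos F N p.K (g 0) (E p) V₀

/-- **GENERIC NEGATIVE (the sweep's FAIL criterion at `k = 0`)**: for ANY law package, setting `S`, residual data, weights and fluctuation space, if the level-0
background maps `U s` do NOT read their argument (`U s 𝐖 = U s 𝐖'`) then the level-0 slot family of record (= `ρ₀`) does NOT have the §2 form over them as soon as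
`N ≥ 2` and the bare coupling `g 0 ≠ 0` — whatever the term values and constants (v1.0 §§2–4 made generic; `not_sLaw₁₁_zero` is the Stage-11 instance).
[cite: Balaban1988Convergent, Thm 1 p.262, (2.18) p.257 (located negative, generic form)] -/
theorem not_hasSect2FormWithAE_zero_of_const_bg (hN : 2 ≤ N) (p : B12.RunParams) (S : Sect2.Setting 𝔸 (SU N)) (Rz : Sect2.Residual (F.P p.K) 𝔸)
    (Wt : TkWeights F N V p.K) (ν : Stage7Numerics) (τ : TowerNumerics) (E : B12.RunParams → ℝ) (w : StepWeightsOfRecord F N ν τ.M)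
    (ppSel : PpSelOfRecord F ν τ.M) {g : ℕ → ℝ} (hg : g 0 ≠ 0)
    {U : SeqOfRecord F ν τ.M g p.K 0 → BgMap F N p.K} (hU : ∀ s W W', U s W = U s W')
    (law : SeqOfRecord F ν τ.M g p.K 0 → Sect2.TermValues (F.P p.K) 𝔸 V τ.M → Prop) :
    ¬ HasSect2FormWithAE F N V p.K S Rz Wt 0 U law (slotsOfRecord F N ν τ E w ppSel p g 0) := fun h => by
  obtain ⟨c, hc⟩ := hasSect2FormWithAE_zero_ae_eq_const F N V h hU (Seq.zero _)
  obtain ⟨U₁, U₂, h12⟩ := exists_wilsonAction4_ne F N hN p.K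
  exact h12 (wilsonAction4_eq_of_ae_const_rhoZero F N p.K hg (E p) c hc U₁ U₂)

/-- **GENERIC REPAIRED BASE (the sweep's PASS criterion at `k = 0`)**: for ANY setting `S` whose flow starts at the run's bare coupling (`S.flow.g 0 = g 0`), ANY
residual data, weights and fluctuation space, and ANY level-0 background maps that READ THE SCALE-0 VARIABLES (`U s 𝐖 = 𝐖 0` — the print's `U₀ = U`, [III] Thm 1
p. 262), the level-0 slot family of record HAS the §2 form at index 0 (pure slot, zero term values, `E_0(s) := E p`), NO further hypothesis — the face a successor
record pinning the level-0 background by value cites BY NAME (v1.0 §6 is the Stage-11-setting instance). [cite: Balaban1988Convergent, Thm 1 p.262, (2.18) p.257, (2.23)–(2.24) pp.258–259] -/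
theorem hasSect2FormAE_zero_of_bg_readsScaleZero (p : B12.RunParams) (S : Sect2.Setting 𝔸 (SU N)) (Rz : Sect2.Residual (F.P p.K) 𝔸)
    (Wt : TkWeights F N V p.K) (ν : Stage7Numerics) (τ : TowerNumerics) (E : B12.RunParams → ℝ) (w : StepWeightsOfRecord F N ν τ.M)
    (ppSel : PpSelOfRecord F ν τ.M) {g : ℕ → ℝ} (hflow : S.flow.g 0 = g 0)
    {U : SeqOfRecord F ν τ.M g p.K 0 → BgMap F N p.K} (hU : ∀ s W, U s W = W 0) :
    HasSect2FormAE F N V p.K S Rz Wt 0 U (slotsOfRecord F N ν τ E w ppSel p g 0) := by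
  refine ⟨fun _ => Sect2.TermValues.zero, fun _ => E p, Sect2.universalE_const _, fun s => ⟨?_, ?_⟩⟩
  · exact Sect2.LawsRT.zero _ _
  · refine Filter.Eventually.of_forall fun V₀ _ => ?_
    rw [show slotsOfRecord F N ν τ E w ppSel p g 0 s V₀ = rhoZeroOfRecord F N p.K (g 0) (E p) V₀ from rfl]
    simp only [sect2Slot, TkOfRecord_zero, sect2Operand, Tk.baseCfg_snd, hU, fst_baseCfg_zero, action23_zero,
      (wilsonLocal_sect2ActionDataOfRecord F N V p.K _ _ s _ _ _).1, (wilsonLocal_sect2ActionDataOfRecord F N V p.K _ _ s _ _ _).2]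
    rw [show B14.LocalCoupling.invSq S.flow Rz.phi 0 = fun _ => 1 / (S.flow.g 0) ^ 2 from rfl, hflow]
    rw [B14.Eq225Concrete.smearedWilson_const, wilsonAction_eq_mul, rhoZeroOfRecord, Missing.boltzmann, ← Real.exp_add]
    congr 1
    rw [inv_pow, one_div]
    ring

end Generic

end Literature.MathematicalPhysics.QuantumFieldTheory.Balaban1983to89.B16Thm1BaseAtRecord11

end
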